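import Summits.PneNP.PneNP.Theses.NtimeComplementLadder
import Literature.Computability.Complexity.NPEqUnionNTIME

/-!
# Birth skeleton (BC3) — crux `ClimbToNPneCoNP` of route `NtimeComplementLadder` (item stmt-PneNP-18522)

The crux is the route's DECLARED RESIDUAL
`ClimbToNPneCoNP : ConlinNotInNlin → NP ≠ coNP` ("rung 1 climbs to `NP ≠ coNP`").
The line makes the climb pass through the exponent LADDER
`Ladder : ∀ c ≥ 1, coNTIME(n) ⊄ NTIME(n^c)` and splits it into

* `stub_climb` — the residual proper: rung 1 (`coNTIME(n) ⊄ NTIME(n)`) gives every rung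
  (`NP ≠ coNP` above rung 1; imported, not attacked; open);
* the CALIBRATION `Ladder → NP ≠ coNP`, proved here (`calibrate_of_stubs`, ladder written out) from two provable,
  machine-level stubs:
  * `stub_hardLanguage` — one language `H ∈ NP` to which every `NTIME(n)` language reduces by a
    deterministic `O(n^a)`-time map of output length `O(n^a)` with ONE exponent `a` for the whole
    class (a clocked universal verifier language, or Cook–Levin with a uniform exponent for
    linear-time verifiers; Book 1974 / Cook 1971, Arora–Barak 2009 Thm. 2.10 read with explicit
    exponents);
  * `stub_reductionClosure` — pull-back of `NTIME(n^k)` along such a map lands in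
    `NTIME(n^(a·max k 1))` (compose the transducer with the verifier and re-clock the witness
    bound; Arora–Barak 2009 §2.1.2, the argument of `NTIME_mono_holds` / `NP_subset_iUnion_NTIME`).

Calibration: if `NP = coNP` then `Hᶜ ∈ NP ⊆ ⋃ₖ NTIME(n^k)` (`NP_subset_iUnion_NTIME`, proved in the
tree), say `Hᶜ ∈ NTIME(n^k)`; every `L ∈ coNTIME(n)` has `Lᶜ ∈ NTIME(n)`, so `Lᶜ` reduces to `H`,
so `L` reduces to `Hᶜ` by the same map, so `L ∈ NTIME(n^(a·max k 1))` — i.e.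
`coNTIME(n) ⊆ NTIME(n^c)` with `c = a·max k 1 ≥ 1`, contradicting the ladder at `c`.

`climb_of_sigs` proves (no sorry) that the three stub STATEMENTS imply the crux body; `ClimbToNPneCoNP_of`
concludes the crux BY NAME from the three stubs by name (A12 registrar shape); `sorry` occurs only inside
`stub_*`.
-/

set_option linter.dupNamespace false

namespace Summit.PneNP.PneNP.Cruxes.ClimbToNPneCoNP.Birth

open Literature.Computability.Complexity
open Summit.PneNP.PneNP.Theses.NtimeComplementLadder

/-- STUB (the residual proper, open): rung 1 climbs the whole ladder —
`coNTIME(n) ⊄ NTIME(n)` gives `coNTIME(n) ⊄ NTIME(n^c)` for every `c ≥ 1`.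
This is `NP ≠ coNP` above rung 1 (imported, not attacked by the route). -/
theorem stub_climb :
    Summit.PneNP.PneNP.Theses.NtimeComplementLadder.ConlinNotInNlin →
      ∀ c : ℕ, 1 ≤ c → ¬ (Literature.Computability.Complexity.coNTIME (fun n : ℕ => n) ⊆
        Literature.Computability.Complexity.NTIME (fun n : ℕ => n ^ c)) := by
  sorry

/-- STUB (provable, M/L): a single `NP` language hard for `NTIME(n)` under deterministic
`O(n^a)`-time, `O(n^a)`-length many-one reductions with ONE exponent `a ≥ 1` for the whole class
(clocked universal verifier language / uniform-exponent Cook–Levin). -/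
theorem stub_hardLanguage :
    ∃ (H : Language Bool) (a : ℕ), 1 ≤ a ∧
      H ∈ Literature.Computability.Complexity.Nondeterministic.NP ∧
      ∀ L ∈ Literature.Computability.Complexity.NTIME (fun n : ℕ => n),
        ∃ (f : List Bool → List Bool) (d : ℕ),
          f ∈ Literature.Computability.Complexity.FTIME (fun n : ℕ => n ^ a) ∧
          (∀ x : List Bool, (f x).length ≤ d * x.length ^ a + d) ∧
          ∀ x : List Bool, x ∈ L ↔ f x ∈ H := by
  sorry

/-- STUB (provable, M): `NTIME(n^k)` pulls back along a deterministic `O(n^a)`-time map of output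
length `≤ d·n^a + d` into `NTIME(n^(a·max k 1))` (transducer ∘ verifier, witness bound re-clocked
with the time-constructible `n ↦ n^(a·max k 1)`). -/
theorem stub_reductionClosure :
    ∀ (a k d : ℕ) (L H : Language Bool) (f : List Bool → List Bool), 1 ≤ a →
      f ∈ Literature.Computability.Complexity.FTIME (fun n : ℕ => n ^ a) →
      (∀ x : List Bool, (f x).length ≤ d * x.length ^ a + d) →
      (∀ x : List Bool, x ∈ L ↔ f x ∈ H) →
      H ∈ Literature.Computability.Complexity.NTIME (fun n : ℕ => n ^ k) →
      L ∈ Literature.Computability.Complexity.NTIME (fun n : ℕ => n ^ (a * max k 1)) := by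
  sorry

/-! ### The calibration `Ladder → NP ≠ coNP`, proved from the two machine-level stubs -/

/-- CALIBRATION (no sorry): a hard language with a uniform reduction exponent plus the pull-back
closure of `NTIME(n^k)` turn the ladder into `NP ≠ coNP`. -/
theorem calibrate_of_stubs
    (hH : ∃ (H : Language Bool) (a : ℕ), 1 ≤ a ∧
      H ∈ Literature.Computability.Complexity.Nondeterministic.NP ∧
      ∀ L ∈ Literature.Computability.Complexity.NTIME (fun n : ℕ => n),
        ∃ (f : List Bool → List Bool) (d : ℕ),
          f ∈ Literature.Computability.Complexity.FTIME (fun n : ℕ => n ^ a) ∧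
          (∀ x : List Bool, (f x).length ≤ d * x.length ^ a + d) ∧
          ∀ x : List Bool, x ∈ L ↔ f x ∈ H)
    (hR : ∀ (a k d : ℕ) (L H : Language Bool) (f : List Bool → List Bool), 1 ≤ a →
      f ∈ Literature.Computability.Complexity.FTIME (fun n : ℕ => n ^ a) →
      (∀ x : List Bool, (f x).length ≤ d * x.length ^ a + d) →
      (∀ x : List Bool, x ∈ L ↔ f x ∈ H) →
      H ∈ Literature.Computability.Complexity.NTIME (fun n : ℕ => n ^ k) →
      L ∈ Literature.Computability.Complexity.NTIME (fun n : ℕ => n ^ (a * max k 1))) :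
    (∀ c : ℕ, 1 ≤ c → ¬ (Literature.Computability.Complexity.coNTIME (fun n : ℕ => n) ⊆
        Literature.Computability.Complexity.NTIME (fun n : ℕ => n ^ c))) →
    Literature.Computability.Complexity.Nondeterministic.NP ≠
      Literature.Computability.Complexity.coNP := by
  intro hLadder hEq
  obtain ⟨H, a, ha, hHNP, hred⟩ := hH
  -- `NP = coNP` puts `Hᶜ` in `NP`, hence in some `NTIME(n^k)`
  have hHc : Hᶜ ∈ Nondeterministic.NP := by
    have h' : H ∈ coNP := hEq ▸ hHNP
    simpa only [coNP, co, Set.mem_setOf_eq] using h'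
  obtain ⟨k, hk⟩ := Set.mem_iUnion.1 (NP_subset_iUnion_NTIME hHc)
  -- every `coNTIME(n)` language then lies in `NTIME(n^(a * max k 1))`
  have hsub : coNTIME (fun n : ℕ => n) ⊆ NTIME (fun n : ℕ => n ^ (a * max k 1)) := by
    intro L hL
    have hLc : Lᶜ ∈ NTIME (fun n : ℕ => n) := by
      simpa only [coNTIME, co, Set.mem_setOf_eq] using hL
    obtain ⟨f, d, hf, hlen, hiff⟩ := hred Lᶜ hLc
    have hiff' : ∀ x : List Bool, x ∈ L ↔ f x ∈ Hᶜ := by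
      intro x
      have hx : x ∉ L ↔ f x ∈ H := hiff x
      have h2 : f x ∈ Hᶜ ↔ f x ∉ H := Iff.rfl
      rw [h2]
      tauto
    exact hR a k d L Hᶜ f ha hf hlen hiff' hk
  have hc : 1 ≤ a * max k 1 := one_le_mul ha (le_max_right k 1)
  exact hLadder (a * max k 1) hc hsub

/-- COMPOSITION, implication form (kernel-checked, no sorry, no stub used): the three stub STATEMENTS
imply the crux; the conclusion is the crux body `ConlinNotInNlin → NP ≠ coNP` written out (the by-name
conclusion is `ClimbToNPneCoNP_of` below, whose hypotheses must be the stubs BY NAME for the registrar). -/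
theorem climb_of_sigs
    (hClimb : Summit.PneNP.PneNP.Theses.NtimeComplementLadder.ConlinNotInNlin →
      ∀ c : ℕ, 1 ≤ c → ¬ (Literature.Computability.Complexity.coNTIME (fun n : ℕ => n) ⊆
        Literature.Computability.Complexity.NTIME (fun n : ℕ => n ^ c)))
    (hH : ∃ (H : Language Bool) (a : ℕ), 1 ≤ a ∧
      H ∈ Literature.Computability.Complexity.Nondeterministic.NP ∧
      ∀ L ∈ Literature.Computability.Complexity.NTIME (fun n : ℕ => n),
        ∃ (f : List Bool → List Bool) (d : ℕ),
          f ∈ Literature.Computability.Complexity.FTIME (fun n : ℕ => n ^ a) ∧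
          (∀ x : List Bool, (f x).length ≤ d * x.length ^ a + d) ∧
          ∀ x : List Bool, x ∈ L ↔ f x ∈ H)
    (hR : ∀ (a k d : ℕ) (L H : Language Bool) (f : List Bool → List Bool), 1 ≤ a →
      f ∈ Literature.Computability.Complexity.FTIME (fun n : ℕ => n ^ a) →
      (∀ x : List Bool, (f x).length ≤ d * x.length ^ a + d) →
      (∀ x : List Bool, x ∈ L ↔ f x ∈ H) →
      H ∈ Literature.Computability.Complexity.NTIME (fun n : ℕ => n ^ k) →
      L ∈ Literature.Computability.Complexity.NTIME (fun n : ℕ => n ^ (a * max k 1))) :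
    Summit.PneNP.PneNP.Theses.NtimeComplementLadder.ConlinNotInNlin →
      Literature.Computability.Complexity.Nondeterministic.NP ≠
        Literature.Computability.Complexity.coNP :=
  fun hX1 => calibrate_of_stubs hH hR (hClimb hX1)

/-- THE SKELETON THEOREM (A12 shape): concludes the crux BY NAME from the three declared stubs by name;
its only debt is the three `stub_*` sorries (no direct sorry here). -/
theorem ClimbToNPneCoNP_of :
    Summit.PneNP.PneNP.Theses.NtimeComplementLadder.ClimbToNPneCoNP :=
  climb_of_sigs stub_climb stub_hardLanguage stub_reductionClosure

end Summit.PneNP.PneNP.Cruxes.ClimbToNPneCoNP.Birth
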